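import Summits.PneNP.PneNP.Theorems.ChebyshevTracialDesignTightLinks
import HarnessLib

/-!
# Cell pnp-psdrank, route `ChebyshevTracialDesign`: THE TIGHT MASS IS A SUM OVER EVEN SETS — the biclique decomposition of `Q_1(t)` as a sum identity
# (crux `TracialDecayExp20`, stmt-PneNP-19878)

Brick 77 (prover g13; MEMO-16 §1 (⋆)). By brick 71 every tight pair `(U, M)` (`|U| = t`, `cc(U,M) = 1`) arises from EXACTLY ONE triple `(W, a, M)` with
`|W| = t − 1`, `a ∉ W`, `U = W + a` and `M` splitting along `W` (`crossCount W M = 0`). This file turns the bijection into sum identities: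
* `sum_Qset_one_eq_sum_triples` — for any `F`, `Σ_{(U,M) ∈ Q_1(t)} F(U, M) = Σ_{(W,a,M) : |W| = t−1, a ∉ W, cc(W,M) = 0} F(W + a, M)` (`t` odd);
* `sum_Qset_one_mul_eq` — for product weights, `Σ_{(U,M) ∈ Q_1(t)} f(U) g(M) = Σ_{|W| = t−1} (Σ_{a ∉ W} f(W + a)) · (Σ_{M : cc(W,M) = 0} g(M))`:
  THE TIGHT MASS OF A WEIGHTED RECTANGLE IS THE SUM OVER EVEN SETS OF (upper-shadow weight) × (splitting mass). Read with brick 70b's weighted mass form of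
  spectral non-tightness this is an 'SNT₀ in shadow form' — a lower bound on `Σ_W x(Star⁺ W)·z(Z(W))` for dense `x` and homogeneous-dense `z` — for free.
[cite: Rothvoss2017, §2 (PDF p. 6: the pairs `Q_ℓ`, the tight pairs `Q_1`)] Stature: support/instrument (double counting).
WHAT THIS IS NOT: no new inequality, nothing on psd rank of P_PM(K_n), no P-vs-NP content.
-/

set_option linter.dupNamespace false -- `Summit.PneNP.PneNP.…`: summit = sub-problem (D-0017)

noncomputable section

namespace Summit.PneNP.PneNP.Theorems.ChebyshevTracialDesignTightMassBicliques

open Finset Literature.Barriers.PneNP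
open Literature.Combinatorics.AssociationSchemes.CutMatchingRestriction
open Summit.PneNP.PneNP.Theorems.ChebyshevTracialDesignTightLinks

variable {n : ℕ}

/-- **`Q_1(t)` is in bijection with the triples `(W, a, M)`, `|W| = t − 1`, `a ∉ W`, `cc(W, M) = 0`** (via `(W, a, M) ↦ (W + a, M)`), as a sum identity:
for odd `t` and every `F : Finset (Fin n) → PMatch n → β`,
`Σ_{(U,M) ∈ Q_1(t)} F(U,M) = Σ_{(W,a,M)} F(W + a, M)`. [cite: Rothvoss2017, §2 (PDF p. 6: the tight pairs `Q_1`)] -/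
theorem sum_Qset_one_eq_sum_triples {β : Type*} [AddCommMonoid β] {t : ℕ} (ht : Odd t) (F : Finset (Fin n) → PMatch n → β) :
    ∑ p ∈ Qset n t 1, F p.1.1 p.2 =
      ∑ q ∈ ((univ : Finset (Finset (Fin n))) ×ˢ (univ : Finset (Fin n)) ×ˢ (univ : Finset (PMatch n))).filter
          (fun q => q.1.card + 1 = t ∧ q.2.1 ∉ q.1 ∧ crossCount q.1 q.2.2.1 = 0),
        F (insert q.2.1 q.1) q.2.2 := by
  classical
  symm
  refine sum_bij (fun q hq => (⟨insert q.2.1 q.1, ?odd⟩, q.2.2)) ?hi ?hinj ?hsurj ?hF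
  case odd =>
    obtain ⟨hc, ha, -⟩ := (mem_filter.1 hq).2
    rw [card_insert_of_notMem ha, hc]; exact ht
  case hi =>
    intro q hq
    obtain ⟨hc, ha, h0⟩ := (mem_filter.1 hq).2
    refine mem_Qset_iff.2 ⟨by rw [card_insert_of_notMem ha, hc], ?_⟩
    rw [cc_eq_crossCount]
    exact crossCount_insert_eq_one_of_zero q.2.2.2 (mem_univ _) ha h0
  case hinj =>
    rintro ⟨W, a, M⟩ hq ⟨W', a', M'⟩ hq' heq
    obtain ⟨hc, ha, h0⟩ := (mem_filter.1 hq).2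
    obtain ⟨hc', ha', h0'⟩ := (mem_filter.1 hq').2
    dsimp only at hc ha h0 hc' ha' h0'
    simp only [Prod.mk.injEq, Subtype.mk.injEq] at heq
    obtain ⟨hU, hM⟩ := heq
    subst hM
    -- both `a` and `a'` are the deleted vertex of the same tight cut: `a = a'` by `splits_below_unique`
    have hodd : Odd (insert a W).card := by rw [card_insert_of_notMem ha, hc]; exact ht
    have haU : a ∈ insert a W := mem_insert_self a W
    have ha'U : a' ∈ insert a W := by rw [hU]; exact mem_insert_self a' W'
    have h0U : crossCount ((insert a W).erase a) M.1 = 0 := by rw [erase_insert ha]; exact h0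
    have h0U' : crossCount ((insert a W).erase a') M.1 = 0 := by rw [hU, erase_insert ha']; exact h0'
    have haa' : a = a' := splits_below_unique (U := ⟨insert a W, hodd⟩) haU ha'U h0U h0U'
    subst haa'
    have hWW' : W = W' := by rw [← erase_insert ha, hU, erase_insert ha']
    subst hWW'
    rfl
  case hsurj =>
    rintro ⟨U, M⟩ hp
    obtain ⟨hcard, hcc⟩ := mem_Qset_iff.1 hp
    obtain ⟨a, b, -, haU, -, h0, -⟩ := exists_splits_of_cc_eq_one hcc
    refine ⟨(U.1.erase a, a, M), mem_filter.2 ⟨?_, ?_, notMem_erase a U.1, h0⟩, ?_⟩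
    · simp only [mem_product, mem_univ, and_self]
    · have hcard' : U.1.card = t := hcard
      show (U.1.erase a).card + 1 = t
      rw [card_erase_of_mem haU]
      have := card_pos.2 ⟨a, haU⟩
      omega
    · simp only [insert_erase haU]
  case hF =>
    intro q hq
    rfl

/-- **THE TIGHT MASS IS A SUM OVER EVEN SETS.** For odd `t`, `f : Finset (Fin n) → β`, `g : PMatch n → β` (any commutative semiring):
`Σ_{(U,M) ∈ Q_1(t)} f(U)·g(M) = Σ_{|W| = t−1} (Σ_{a ∉ W} f(W + a)) · (Σ_{M : cc(W,M) = 0} g(M))` — each tight pair counted once in its upper biclique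
`Star⁺(W) × Z(W)` (brick 71). With `f = x` a cut weight and `g = z` a matching weight the left side is the tight mass of the weighted rectangle, so every
lower bound on it (brick 70b, mod KL) is a lower bound on the `x(Star⁺ ·)`-weighted splitting masses `z(Z(W))`.
[cite: Rothvoss2017, §2 (PDF p. 6: the tight pairs `Q_1`)] -/
theorem sum_Qset_one_mul_eq {β : Type*} [CommSemiring β] {t : ℕ} (ht : Odd t) (f : Finset (Fin n) → β) (g : PMatch n → β) :
    ∑ p ∈ Qset n t 1, f p.1.1 * g p.2 =
      ∑ W ∈ (univ : Finset (Finset (Fin n))).filter (fun W => W.card + 1 = t),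
        (∑ a ∈ univ.filter (fun a => a ∉ W), f (insert a W)) * (∑ M ∈ univ.filter (fun M : PMatch n => crossCount W M.1 = 0), g M) := by
  classical
  rw [sum_Qset_one_eq_sum_triples ht (fun U M => f U * g M), sum_filter, sum_product]
  have hR : ∑ W ∈ (univ : Finset (Finset (Fin n))).filter (fun W => W.card + 1 = t),
      (∑ a ∈ univ.filter (fun a => a ∉ W), f (insert a W)) * (∑ M ∈ univ.filter (fun M : PMatch n => crossCount W M.1 = 0), g M) =
      ∑ W : Finset (Fin n), if W.card + 1 = t then
        (∑ a ∈ univ.filter (fun a => a ∉ W), f (insert a W)) * (∑ M ∈ univ.filter (fun M : PMatch n => crossCount W M.1 = 0), g M) else 0 :=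
    sum_filter _ _
  rw [hR]
  refine sum_congr rfl fun W _ => ?_
  by_cases hWc : W.card + 1 = t
  · rw [if_pos hWc, sum_mul_sum, sum_filter, sum_product]
    refine sum_congr rfl fun a _ => ?_
    by_cases ha : a ∉ W
    · rw [if_pos ha, sum_filter]
      refine sum_congr rfl fun M _ => ?_
      by_cases h0 : crossCount W M.1 = 0
      · rw [if_pos ⟨hWc, ha, h0⟩, if_pos h0]
      · rw [if_neg (fun h => h0 h.2.2), if_neg h0]
    · rw [if_neg ha]
      exact sum_eq_zero fun M _ => if_neg fun h => ha h.2.1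
  · rw [if_neg hWc]
    exact sum_eq_zero fun q _ => if_neg fun h => hWc h.1

end Summit.PneNP.PneNP.Theorems.ChebyshevTracialDesignTightMassBicliques
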